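import Summits.NavierStokesRegularity.NavierStokesRegularity.Theses.SlicedKelvin
import Summits.NavierStokesRegularity.NavierStokesRegularity.Theorems.SlicedKelvinPlanarFluxAPrioriStubInitialFluxFinite
import Summits.NavierStokesRegularity.NavierStokesRegularity.Theorems.SlicedKelvinPlanarFluxAPrioriHeatKernelDominationOfFoldLaw
import HarnessLib.Audit
import Summits.NavierStokesRegularity.NavierStokesRegularity.Theorems.SlicedKelvinDefs
import Summits.NavierStokesRegularity.NavierStokesRegularity.Theorems.SlicedKelvinPlanarFluxAPrioriStubDecayPersistence
import Summits.NavierStokesRegularity.NavierStokesRegularity.Theorems.SlicedKelvinPlanarFluxAPrioriStubEpsFoldLaw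
import Summits.NavierStokesRegularity.NavierStokesRegularity.Theorems.SlicedKelvinPlanarFluxAPrioriStubFoldLawPackage

/-!
# Skeleton (reshaped, rev 3) of the crux `SlicedKelvin.PlanarFluxAPriori` — line `registered` (= BC3 birth)

(crux item `stmt-NavierStokesRegularity-15600`, rank 2, route `route-NavierStokesRegularity-SlicedKelvin`;
tree path `Cruxes/PlanarFluxAPriori/Lines/birth.lean`; registrar `planner-skel-stmt-NavierStokesRegularity-15600-0`
(rev 1, 2026-08-17), reshaped by the line lead `prover-line-stmt-NavierStokesRegularity-15600-0` (rev 2 after wave 1,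
rev 3 after wave 2, 2026-08-17).)

THE CUT (unchanged). `PlanarFluxAPriori` (along every classical Leray–Hopf solution on `[0,T)` from a rapidly
decaying datum, the UNSIGNED VORTICITY FLUX `Φ(t;R,c) = ∫_{R{x₂=c}} |curl u(t) · R e₂| dA` is bounded over all
planes and all `t < T`) is cut along the FOLD LAW: `Φ(t;R,c) ≤ sup_{c'} Φ(0;R,c') + C · D(u;R,t)` (heat-kernel
domination, `D` the Duhamel fold-creation functional `liminf_{ε→0⁺} ∫⁻_{τ∈(0,t)} (ν(t−τ))^{-1/2} Σ_ε(u τ;R) dτ`,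
`Σ_ε = ∫⁻ (s_ε)⁺`, `s_ε = Theorems.SlicedKelvin.foldDensity`), plus the initial bound `Φ(0;R,c) ≤ A` and the
FOLD-CREATION BUDGET `D(u;R,t) ≤ B`.

WHAT CHANGED IN REV 2 (wave 1 of the line):
* `stub_initialFluxFinite` LANDED (p146719, `Theorems.SlicedKelvinPlanarFluxAPriori.stub_initialFluxFinite`) — it is
  now a closed theorem of this file (`initialFluxFinite`).
* `stub_heatKernelDomination` was REDUCED by the landed closed glue
  `Theorems.SlicedKelvinPlanarFluxAPriori.stub_heatKernelDomination_of_foldLawSubsolution` (p149095; with the landed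
  helpers EpsilonLimit p147068, Foliation p147146, HeatKernel1D p147762, HeatPairing p148106, HeatDuality p148375:
  the 1-D heat Duhamel comparison, Fubini over the foliation, the ε → 0⁺ bookkeeping are PROVED) to the
  ε-FOLD-LAW SUBSOLUTION PACKAGE `Theorems.SlicedKelvin.FoldLawSubsolution ν T u` (definitions landed in
  `Theorems/SlicedKelvinDefs.lean`). The package is cut into three registered stubs:
  - `stub_decayPersistence` [L/XL, KNOWN THEOREM]: cubic spatial decay of `u, ∇u, ∇²u, ∇³u` persists, uniformly on
    every `[0,t] ⊂ [0,T)` (weak–strong uniqueness `serrin_weak_strong_uniqueness_holds` onto the Fujita–Kato solution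
    `fujita_kato_local_holds`, space decay of mild solutions `|x|⁻⁴` (Brandolese 2004, Kukavica–Torres 2006), and
    far-field regularity of Leray–Hopf solutions from decaying data (CKN 1982 Thm D) to exclude an earlier strong
    blow-up time; the same debt as `Cruxes/PlanarEnergyAPriori`'s `stub_decayPersistence`).
  - `stub_epsFoldLaw` [L, provable now]: the frame-covariant ε-fold law identity
    `Theorems.SlicedKelvin.EpsFoldLawOn ν ε c R v` for smooth divergence-free `v` with cubic decay (route support
    `FoldLawEps`, stmt-15606, in a general frame and under polynomial decay): three in-plane integrations by parts.
  - `stub_foldLawPackage` [L/XL, provable now]: fold-law identity (as a hypothesis, = `stub_epsFoldLaw`'s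
    statement) + classical solution + cubic decay on `[0,t]` ⟹ `FoldLawSubsolution ν T u` (vorticity equation
    `IsClassicalNSSolutionOn.isVorticitySolutionOn_of_convex`, differentiation under the plane integral, joint
    continuity and uniform bounds of `φ_ε, ∂_τφ_ε, ∂_cφ_ε, ∂_c²φ_ε`, and the inequality: drop
    `−ν∫F''|∇f|² ≤ 0`, bound `∫ s_ε ≤ ∫ s_ε⁺`).
  `heatKernelDomination` (the old stub's statement) is now a closed theorem of this file modulo those three.
WHAT CHANGED IN REV 3 (wave 2 of the line): ALL THREE rev-2 stubs LANDED —
  `stub_decayPersistence` p156374 (`Theorems.SlicedKelvinPlanarFluxAPriori.stub_decayPersistence`, with helpers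
  DecayKernelWeights p153199, DecayHeatWeight p153286, DecayDuhamelWeighted p153879, DecayOseenRepresentation p154393,
  DecayLineDeriv p154798, DecaySlabBounds p155259, DecayBootstrapStep p155332, DecayBootstrap p155812, DecayLevels p155955),
  `stub_epsFoldLaw` p155891 (helpers PlaneChart p153650, FoldPointwise p155263, FoldDecay p155171),
  `stub_foldLawPackage` p156495 (helpers PlaneCalculus p153512, SqrtReg p153655, FoldLawDecay p155169, FoldLawSpaceTime
  p155465). Hence `heatKernelDomination` (heat-kernel domination of the planar flux by the initial flux plus
  `(4π)^{-1/2} ·` the Duhamel fold-creation functional) is now a CLOSED THEOREM: the whole provable-now layer of the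
  route's two-layer plan (`HeatKernelFluxBound`) is in the tree.
* `stub_foldCreationBudget` [XL, OPEN — the hardest stub, held by the lead] unchanged: it is the ONLY remaining `sorry`;
  the crux `PlanarFluxAPriori` is now formally EQUIVALENT-IN-DIFFICULTY to the route's declared real crux
  `FoldCreationBudget` (D(u;R,t) ≤ B uniformly in frames and t < T).

COMPOSITION. `planarFluxAPriori_of_stubs` (closed, rev 1, ~12 lines of `ℝ≥0∞` bookkeeping) and
`PlanarFluxAPriori_of : Theses.SlicedKelvin.PlanarFluxAPriori := planarFluxAPriori_of_stubs initialFluxFinite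
heatKernelDomination stub_foldCreationBudget` (A12 by-name form; after rev 3 `sorry` only inside the single registered stub `stub_foldCreationBudget`).
-/

noncomputable section

namespace Summit.NavierStokesRegularity.NavierStokesRegularity.Cruxes.PlanarFluxAPriori.Birth

set_option linter.unusedVariables false
set_option linter.dupNamespace false


/-- **stub 1 — CLOSED (landed p146719).** A rapidly decaying field has unsigned planar vorticity flux bounded
uniformly over all frames and heights. -/
theorem initialFluxFinite :
    ∀ (u₀ : EuclideanSpace ℝ (Fin 3) → EuclideanSpace ℝ (Fin 3)),
      Literature.Analysis.FluidPDE.HasRapidSpatialDecay u₀ → ∃ A : NNReal, ∀ (R : EuclideanSpace ℝ (Fin 3)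
      ≃ₗᵢ[ℝ] EuclideanSpace ℝ (Fin 3)) (c : ℝ), ∫⁻ y : EuclideanSpace ℝ (Fin 2), ‖inner ℝ
      (Literature.Analysis.FluidPDE.curl u₀ (R (WithLp.toLp 2 ![y 0, y 1, c]))) (R (EuclideanSpace.single 2
      1))‖ₑ ≤ (A : ENNReal) :=
  _root_.Summit.NavierStokesRegularity.NavierStokesRegularity.Theorems.SlicedKelvinPlanarFluxAPriori.stub_initialFluxFinite

/-- **stub 2a — CLOSED (landed p156374): decay persists along the classical Leray–Hopf solution.** For every `t < T` there is `C₀` with `(1 + ‖x‖)³ ‖Dᵏ(u s) x‖ ≤ C₀` for `k ≤ 3`, `s ∈ [0,t]`,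
`x ∈ ℝ³`. -/
theorem decayPersistence :
    ∀ (ν T : ℝ), 0 < ν → 0 < T → ∀ (u : ℝ → EuclideanSpace ℝ (Fin 3) → EuclideanSpace ℝ (Fin 3)) (p : ℝ → EuclideanSpace ℝ (Fin 3) → ℝ), Literature.Analysis.FluidPDE.IsClassicalNSSolutionOn (Set.Ico 0 T) ν 0 u p → Literature.Analysis.FluidPDE.IsLerayHopfOn T ν 0 (u 0) u → Literature.Analysis.FluidPDE.HasRapidSpatialDecay (u 0) → ∀ t ∈ Set.Ico 0 T, ∃ C₀ : ℝ, ∀ s ∈ Set.Icc 0 t, ∀ (x : EuclideanSpace ℝ (Fin 3)) (k : ℕ), k ≤ 3 → (1 + ‖x‖) ^ 3 * ‖iteratedFDeriv ℝ k (u s) x‖ ≤ C₀ :=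
  _root_.Summit.NavierStokesRegularity.NavierStokesRegularity.Theorems.SlicedKelvinPlanarFluxAPriori.stub_decayPersistence

/-- **stub 2b — CLOSED (landed p155891): the frame-covariant ε-fold law at a fixed time.** -/
theorem epsFoldLaw :
    ∀ (ν ε c : ℝ), 0 < ε → ∀ (R : EuclideanSpace ℝ (Fin 3) ≃ₗᵢ[ℝ] EuclideanSpace ℝ (Fin 3)) (v : EuclideanSpace ℝ (Fin 3) → EuclideanSpace ℝ (Fin 3)), ContDiff ℝ (⊤ : ℕ∞) v → (∃ C : ℝ, ∀ (x : EuclideanSpace ℝ (Fin 3)) (k : ℕ), k ≤ 3 → (1 + ‖x‖) ^ 3 * ‖iteratedFDeriv ℝ k v x‖ ≤ C) → Literature.Analysis.FluidPDE.VectorCalculus.IsDivFree v → Summit.NavierStokesRegularity.NavierStokesRegularity.Theorems.SlicedKelvin.EpsFoldLawOn ν ε c R v :=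
  _root_.Summit.NavierStokesRegularity.NavierStokesRegularity.Theorems.SlicedKelvinPlanarFluxAPriori.stub_epsFoldLaw

/-- **stub 2c — CLOSED (landed p156495): the ε-fold-law subsolution package from the fold-law identity, the
vorticity equation and cubic decay on compact time slabs.** -/
theorem foldLawPackage :
    (∀ (ν ε c : ℝ), 0 < ε → ∀ (R : EuclideanSpace ℝ (Fin 3) ≃ₗᵢ[ℝ] EuclideanSpace ℝ (Fin 3)) (v : EuclideanSpace ℝ (Fin 3) → EuclideanSpace ℝ (Fin 3)), ContDiff ℝ (⊤ : ℕ∞) v → (∃ C : ℝ, ∀ (x : EuclideanSpace ℝ (Fin 3)) (k : ℕ), k ≤ 3 → (1 + ‖x‖) ^ 3 * ‖iteratedFDeriv ℝ k v x‖ ≤ C) → Literature.Analysis.FluidPDE.VectorCalculus.IsDivFree v → Summit.NavierStokesRegularity.NavierStokesRegularity.Theorems.SlicedKelvin.EpsFoldLawOn ν ε c R v) → ∀ (ν T : ℝ), 0 < ν → 0 < T → ∀ (u : ℝ → EuclideanSpace ℝ (Fin 3) → EuclideanSpace ℝ (Fin 3)) (p : ℝ → EuclideanSpace ℝ (Fin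 3) → ℝ), Literature.Analysis.FluidPDE.IsClassicalNSSolutionOn (Set.Ico 0 T) ν 0 u p → (∀ t ∈ Set.Ico 0 T, ∃ C₀ : ℝ, ∀ s ∈ Set.Icc 0 t, ∀ (x : EuclideanSpace ℝ (Fin 3)) (k : ℕ), k ≤ 3 → (1 + ‖x‖) ^ 3 * ‖iteratedFDeriv ℝ k (u s) x‖ ≤ C₀) → Summit.NavierStokesRegularity.NavierStokesRegularity.Theorems.SlicedKelvin.FoldLawSubsolution ν T u :=
  _root_.Summit.NavierStokesRegularity.NavierStokesRegularity.Theorems.SlicedKelvinPlanarFluxAPriori.stub_foldLawPackage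

/-- **Heat-kernel domination (the rev-1 stub `stub_heatKernelDomination`), CLOSED since rev 3:**
the landed glue `stub_heatKernelDomination_of_foldLawSubsolution` applied to the package delivered by
`stub_foldLawPackage stub_epsFoldLaw` along the decay of `stub_decayPersistence` (the package definition
`Theorems.SlicedKelvin.FoldLawSubsolution` unfolds definitionally to the glue's hypothesis). -/
theorem heatKernelDomination :
    ∃ C : NNReal, ∀ (ν T : ℝ), 0 < ν → 0 < T → ∀ (u : ℝ → EuclideanSpace ℝ (Fin 3) → EuclideanSpace ℝ (Fin
      3)) (p : ℝ → EuclideanSpace ℝ (Fin 3) → ℝ), Literature.Analysis.FluidPDE.IsClassicalNSSolutionOn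
      (Set.Ico 0 T) ν 0 u p → Literature.Analysis.FluidPDE.IsLerayHopfOn T ν 0 (u 0) u →
      Literature.Analysis.FluidPDE.HasRapidSpatialDecay (u 0) → ∀ t ∈ Set.Ico 0 T, ∀ (R : EuclideanSpace ℝ
      (Fin 3) ≃ₗᵢ[ℝ] EuclideanSpace ℝ (Fin 3)) (c : ℝ), ∫⁻ y : EuclideanSpace ℝ (Fin 2), ‖inner ℝ
      (Literature.Analysis.FluidPDE.curl (u t) (R (WithLp.toLp 2 ![y 0, y 1, c]))) (R (EuclideanSpace.single
      2 1))‖ₑ ≤ (⨆ c' : ℝ, ∫⁻ y : EuclideanSpace ℝ (Fin 2), ‖inner ℝ (Literature.Analysis.FluidPDE.curl (u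
      0) (R (WithLp.toLp 2 ![y 0, y 1, c']))) (R (EuclideanSpace.single 2 1))‖ₑ) + (C : ENNReal) *
      Filter.liminf (fun ε : ℝ => ∫⁻ τ in Set.Ioo 0 t, ENNReal.ofReal (1 / Real.sqrt (ν * (t - τ))) * (∫⁻ x
      : EuclideanSpace ℝ (Fin 3), ENNReal.ofReal (-(inner ℝ (u τ x) (R (EuclideanSpace.single 2 1))) * (ε ^
      2 / Real.sqrt (inner ℝ (Literature.Analysis.FluidPDE.curl (u τ) x) (R (EuclideanSpace.single 2 1)) ^ 2
      + ε ^ 2) ^ 3) * (inner ℝ (Literature.Analysis.FluidPDE.curl (u τ) x) (R (EuclideanSpace.single 0 1)) *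
      fderiv ℝ (fun z => inner ℝ (Literature.Analysis.FluidPDE.curl (u τ) z) (R (EuclideanSpace.single 2
      1))) x (R (EuclideanSpace.single 0 1)) + inner ℝ (Literature.Analysis.FluidPDE.curl (u τ) x) (R
      (EuclideanSpace.single 1 1)) * fderiv ℝ (fun z => inner ℝ (Literature.Analysis.FluidPDE.curl (u τ) z)
      (R (EuclideanSpace.single 2 1))) x (R (EuclideanSpace.single 1 1))) - ε ^ 2 * fderiv ℝ (fun z => inner
      ℝ (u τ z) (R (EuclideanSpace.single 2 1))) x (R (EuclideanSpace.single 2 1)) / Real.sqrt (inner ℝ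
      (Literature.Analysis.FluidPDE.curl (u τ) x) (R (EuclideanSpace.single 2 1)) ^ 2 + ε ^ 2))))
      (nhdsWithin 0 (Set.Ioi 0)) :=
  _root_.Summit.NavierStokesRegularity.NavierStokesRegularity.Theorems.SlicedKelvinPlanarFluxAPriori.stub_heatKernelDomination_of_foldLawSubsolution
    (fun ν T hν hT u p hcl hLH hdec =>
      foldLawPackage epsFoldLaw ν T hν hT u p hcl (decayPersistence ν T hν hT u p hcl hLH hdec))

/-- **stub 3 — `stub_foldCreationBudget` (XL, OPEN — the hardest stub; the route's `FoldCreationBudget`).**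
Along every classical Leray–Hopf solution on `[0,T)` from a rapidly decaying datum the Duhamel fold-creation
functional is bounded uniformly over all frames `R` and all `t ∈ [0,T)`. -/
theorem stub_foldCreationBudget :
    ∀ (ν T : ℝ), 0 < ν → 0 < T → ∀ (u : ℝ → EuclideanSpace ℝ (Fin 3) → EuclideanSpace ℝ (Fin 3)) (p : ℝ →
      EuclideanSpace ℝ (Fin 3) → ℝ), Literature.Analysis.FluidPDE.IsClassicalNSSolutionOn (Set.Ico 0 T) ν 0
      u p → Literature.Analysis.FluidPDE.IsLerayHopfOn T ν 0 (u 0) u →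
      Literature.Analysis.FluidPDE.HasRapidSpatialDecay (u 0) → ∃ B : NNReal, ∀ (R : EuclideanSpace ℝ (Fin
      3) ≃ₗᵢ[ℝ] EuclideanSpace ℝ (Fin 3)), ∀ t ∈ Set.Ico 0 T, Filter.liminf (fun ε : ℝ => ∫⁻ τ in Set.Ioo 0
      t, ENNReal.ofReal (1 / Real.sqrt (ν * (t - τ))) * (∫⁻ x : EuclideanSpace ℝ (Fin 3), ENNReal.ofReal
      (-(inner ℝ (u τ x) (R (EuclideanSpace.single 2 1))) * (ε ^ 2 / Real.sqrt (inner ℝ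
      (Literature.Analysis.FluidPDE.curl (u τ) x) (R (EuclideanSpace.single 2 1)) ^ 2 + ε ^ 2) ^ 3) * (inner
      ℝ (Literature.Analysis.FluidPDE.curl (u τ) x) (R (EuclideanSpace.single 0 1)) * fderiv ℝ (fun z =>
      inner ℝ (Literature.Analysis.FluidPDE.curl (u τ) z) (R (EuclideanSpace.single 2 1))) x (R
      (EuclideanSpace.single 0 1)) + inner ℝ (Literature.Analysis.FluidPDE.curl (u τ) x) (R
      (EuclideanSpace.single 1 1)) * fderiv ℝ (fun z => inner ℝ (Literature.Analysis.FluidPDE.curl (u τ) z)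
      (R (EuclideanSpace.single 2 1))) x (R (EuclideanSpace.single 1 1))) - ε ^ 2 * fderiv ℝ (fun z => inner
      ℝ (u τ z) (R (EuclideanSpace.single 2 1))) x (R (EuclideanSpace.single 2 1)) / Real.sqrt (inner ℝ
      (Literature.Analysis.FluidPDE.curl (u τ) x) (R (EuclideanSpace.single 2 1)) ^ 2 + ε ^ 2))))
      (nhdsWithin 0 (Set.Ioi 0)) ≤ (B : ENNReal) := by
  sorry

/-- **Composition, closed form.** The three stub STATEMENTS (as hypotheses) imply the crux statement
(conclusion = the body of `Theses.SlicedKelvin.PlanarFluxAPriori`, verbatim): pure bookkeeping in `ℝ≥0∞`,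
`M := ↑(A + C·B)`. No `sorry`, axioms ⊆ {propext, Classical.choice, Quot.sound}. -/
theorem planarFluxAPriori_of_stubs
    (hI : ∀ (u₀ : EuclideanSpace ℝ (Fin 3) → EuclideanSpace ℝ (Fin 3)),
        Literature.Analysis.FluidPDE.HasRapidSpatialDecay u₀ → ∃ A : NNReal, ∀ (R : EuclideanSpace ℝ (Fin 3)
        ≃ₗᵢ[ℝ] EuclideanSpace ℝ (Fin 3)) (c : ℝ), ∫⁻ y : EuclideanSpace ℝ (Fin 2), ‖inner ℝ
        (Literature.Analysis.FluidPDE.curl u₀ (R (WithLp.toLp 2 ![y 0, y 1, c]))) (R (EuclideanSpace.single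
        2 1))‖ₑ ≤ (A : ENNReal))
    (hH : ∃ C : NNReal, ∀ (ν T : ℝ), 0 < ν → 0 < T → ∀ (u : ℝ → EuclideanSpace ℝ (Fin 3) → EuclideanSpace ℝ (Fin
        3)) (p : ℝ → EuclideanSpace ℝ (Fin 3) → ℝ), Literature.Analysis.FluidPDE.IsClassicalNSSolutionOn
        (Set.Ico 0 T) ν 0 u p → Literature.Analysis.FluidPDE.IsLerayHopfOn T ν 0 (u 0) u →
        Literature.Analysis.FluidPDE.HasRapidSpatialDecay (u 0) → ∀ t ∈ Set.Ico 0 T, ∀ (R : EuclideanSpace ℝ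
        (Fin 3) ≃ₗᵢ[ℝ] EuclideanSpace ℝ (Fin 3)) (c : ℝ), ∫⁻ y : EuclideanSpace ℝ (Fin 2), ‖inner ℝ
        (Literature.Analysis.FluidPDE.curl (u t) (R (WithLp.toLp 2 ![y 0, y 1, c]))) (R
        (EuclideanSpace.single 2 1))‖ₑ ≤ (⨆ c' : ℝ, ∫⁻ y : EuclideanSpace ℝ (Fin 2), ‖inner ℝ
        (Literature.Analysis.FluidPDE.curl (u 0) (R (WithLp.toLp 2 ![y 0, y 1, c']))) (R
        (EuclideanSpace.single 2 1))‖ₑ) + (C : ENNReal) * Filter.liminf (fun ε : ℝ => ∫⁻ τ in Set.Ioo 0 t,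
        ENNReal.ofReal (1 / Real.sqrt (ν * (t - τ))) * (∫⁻ x : EuclideanSpace ℝ (Fin 3), ENNReal.ofReal
        (-(inner ℝ (u τ x) (R (EuclideanSpace.single 2 1))) * (ε ^ 2 / Real.sqrt (inner ℝ
        (Literature.Analysis.FluidPDE.curl (u τ) x) (R (EuclideanSpace.single 2 1)) ^ 2 + ε ^ 2) ^ 3) *
        (inner ℝ (Literature.Analysis.FluidPDE.curl (u τ) x) (R (EuclideanSpace.single 0 1)) * fderiv ℝ (fun
        z => inner ℝ (Literature.Analysis.FluidPDE.curl (u τ) z) (R (EuclideanSpace.single 2 1))) x (R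
        (EuclideanSpace.single 0 1)) + inner ℝ (Literature.Analysis.FluidPDE.curl (u τ) x) (R
        (EuclideanSpace.single 1 1)) * fderiv ℝ (fun z => inner ℝ (Literature.Analysis.FluidPDE.curl (u τ)
        z) (R (EuclideanSpace.single 2 1))) x (R (EuclideanSpace.single 1 1))) - ε ^ 2 * fderiv ℝ (fun z =>
        inner ℝ (u τ z) (R (EuclideanSpace.single 2 1))) x (R (EuclideanSpace.single 2 1)) / Real.sqrt
        (inner ℝ (Literature.Analysis.FluidPDE.curl (u τ) x) (R (EuclideanSpace.single 2 1)) ^ 2 + ε ^ 2))))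
        (nhdsWithin 0 (Set.Ioi 0)))
    (hB : ∀ (ν T : ℝ), 0 < ν → 0 < T → ∀ (u : ℝ → EuclideanSpace ℝ (Fin 3) → EuclideanSpace ℝ (Fin 3)) (p : ℝ →
        EuclideanSpace ℝ (Fin 3) → ℝ), Literature.Analysis.FluidPDE.IsClassicalNSSolutionOn (Set.Ico 0 T) ν
        0 u p → Literature.Analysis.FluidPDE.IsLerayHopfOn T ν 0 (u 0) u →
        Literature.Analysis.FluidPDE.HasRapidSpatialDecay (u 0) → ∃ B : NNReal, ∀ (R : EuclideanSpace ℝ (Fin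
        3) ≃ₗᵢ[ℝ] EuclideanSpace ℝ (Fin 3)), ∀ t ∈ Set.Ico 0 T, Filter.liminf (fun ε : ℝ => ∫⁻ τ in Set.Ioo
        0 t, ENNReal.ofReal (1 / Real.sqrt (ν * (t - τ))) * (∫⁻ x : EuclideanSpace ℝ (Fin 3), ENNReal.ofReal
        (-(inner ℝ (u τ x) (R (EuclideanSpace.single 2 1))) * (ε ^ 2 / Real.sqrt (inner ℝ
        (Literature.Analysis.FluidPDE.curl (u τ) x) (R (EuclideanSpace.single 2 1)) ^ 2 + ε ^ 2) ^ 3) *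
        (inner ℝ (Literature.Analysis.FluidPDE.curl (u τ) x) (R (EuclideanSpace.single 0 1)) * fderiv ℝ (fun
        z => inner ℝ (Literature.Analysis.FluidPDE.curl (u τ) z) (R (EuclideanSpace.single 2 1))) x (R
        (EuclideanSpace.single 0 1)) + inner ℝ (Literature.Analysis.FluidPDE.curl (u τ) x) (R
        (EuclideanSpace.single 1 1)) * fderiv ℝ (fun z => inner ℝ (Literature.Analysis.FluidPDE.curl (u τ)
        z) (R (EuclideanSpace.single 2 1))) x (R (EuclideanSpace.single 1 1))) - ε ^ 2 * fderiv ℝ (fun z =>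
        inner ℝ (u τ z) (R (EuclideanSpace.single 2 1))) x (R (EuclideanSpace.single 2 1)) / Real.sqrt
        (inner ℝ (Literature.Analysis.FluidPDE.curl (u τ) x) (R (EuclideanSpace.single 2 1)) ^ 2 + ε ^ 2))))
        (nhdsWithin 0 (Set.Ioi 0)) ≤ (B : ENNReal)) :
    ∀ (ν T : ℝ), 0 < ν → 0 < T → ∀ (u : ℝ → EuclideanSpace ℝ (Fin 3) → EuclideanSpace ℝ (Fin 3)) (p : ℝ →
      EuclideanSpace ℝ (Fin 3) → ℝ), Literature.Analysis.FluidPDE.IsClassicalNSSolutionOn (Set.Ico 0 T) ν 0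
      u p → Literature.Analysis.FluidPDE.IsLerayHopfOn T ν 0 (u 0) u →
      Literature.Analysis.FluidPDE.HasRapidSpatialDecay (u 0) → ∃ M : ℝ, ∀ t ∈ Set.Ico 0 T, ∀ (R :
      EuclideanSpace ℝ (Fin 3) ≃ₗᵢ[ℝ] EuclideanSpace ℝ (Fin 3)) (c : ℝ), ∫⁻ y : EuclideanSpace ℝ (Fin 2),
      ‖inner ℝ (Literature.Analysis.FluidPDE.curl (u t) (R (WithLp.toLp 2 ![y 0, y 1, c]))) (R
      (EuclideanSpace.single 2 1))‖ₑ ≤ ENNReal.ofReal M := by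
  intro ν T hν hT u p hcl hLH hdec
  obtain ⟨A, hA⟩ := hI (u 0) hdec
  obtain ⟨C, hC⟩ := hH
  obtain ⟨B, hB'⟩ := hB ν T hν hT u p hcl hLH hdec
  refine ⟨((A + C * B : NNReal) : ℝ), ?_⟩
  intro t ht R c
  have h1 := hC ν T hν hT u p hcl hLH hdec t ht R c
  have h2 := hB' R t ht
  refine h1.trans ?_
  refine (add_le_add (iSup_le fun c' => hA R c') (mul_le_mul' le_rfl h2)).trans_eq ?_
  rw [ENNReal.ofReal_coe_nnreal, ENNReal.coe_add, ENNReal.coe_mul]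

/-- **The skeleton (A12 by-name form).** The crux BY NAME, modulo exactly ONE registered stub, `stub_foldCreationBudget`. -/
theorem PlanarFluxAPriori_of : Theses.SlicedKelvin.PlanarFluxAPriori :=
  planarFluxAPriori_of_stubs initialFluxFinite heatKernelDomination stub_foldCreationBudget

end Summit.NavierStokesRegularity.NavierStokesRegularity.Cruxes.PlanarFluxAPriori.Birth
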